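import Literature.MathematicalPhysics.QuantumFieldTheory.BalabanImbrieJaffe1984to88.BIJ88Resummation5141
import Literature.MathematicalPhysics.QuantumFieldTheory.BalabanImbrieJaffe1984to88.BIJ88Sect5StatementsPart4

/-!
# `BalabanImbrieJaffe1984to88.BIJ88Result5145` — T. Bałaban, J. Imbrie, A. Jaffe, *Effective action and cluster properties of the
abelian Higgs model*, Commun. Math. Phys. **114** (1988) 257–315 [BalabanImbrieJaffe1988]: Sect. 5.14, p. 312 — the display
**(5.14.5)** (*"To summarize the results of this section"*) TYPED AND ASSEMBLED in the model of `BIJ88Resummation5141` from (5.14.1) and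
the steps of pp. 308–312, with the two steps printed *"without going into details"* (p. 311 extraction of 𝒫^L_{k+1,loc}, p. 312
factorization of the observable) as displayed hypotheses; and the first display of p. 312, `z_F/z = ⟨Π_{σ₁} F^{m̄}_{k,loc}(X_{σ₁})⟩₁`,
in the model.

HONEST FRAMING (cell `lit-balaban`, verbatim): statement-level skeleton of published theorems with citation tags; proofs where landed; nothing here is a claim about the Yang–Mills mass gap.

PDF held: `paper:balaban1988-cmp114-bij-abelian-higgs-effective-action` (journal page = PDF page + 256); p. 308 = PDF p. 52, p. 311 =
PDF p. 55, p. 312 = PDF p. 56 (renders `original-p052-x2.png`, `original-p055-x2.png`, `original-p056-x2.png` in the seat folder).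

CITATION HEADER (verbatim).  p. 308 [PDF 52]: *"We treat z_F(Λ₁₂^{(k)}) as follows: z_F(Λ₁₂^{(k)}) = (z_F(Λ₁₂^{(k)})/z(Λ₁₂^{(k)}))
exp(log z(Λ₁₂^{(k)})), where z(Λ₁₂^{(k)}) = z_{F=1}(Λ₁₂^{(k)}), and we give expansions for z_F/z and log z. The first expansion will
give rise to F^L_{k+1,loc} plus remainders, the second to 𝒫^L_{k+1,loc} plus remainders. … Thus the restrictions and the interactions
disappear at t = 0, at which point we have a purely Gaussian expectation. … Here ⟨·⟩_t is the interacting expectation ⟨·⟩_t =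
(1/z_t(Λ₁₂^{(k)})) ⟨· χ′_{Λ₁₂^{(k)},t} e^{−tṼ^{(k)}(Λ₁₂^{(k)})}⟩_{1,Λ₁₂^{(k)}}"*.  p. 311 [PDF 55]: *"Altogether we have written
V^{(k)}_{const}(Λ₈^{(k)}) + 𝒫̃_{k+1}(Λ₁₂^{(k)}) = 𝒫^L_{k+1,loc}(Λ₈^{(k)}) + Σ_X W₆^{(k)″}(X). If we put W₆^{(k)}(X) = W₆^{(k)′}(X) +
W₆^{(k)″}(X), then …"*.  p. 312 [PDF 56]: *"Then the result of the integration by parts is z_F/z = ⟨Π_{σ₁} F^{m̄}_{k,loc}(X_{σ₁})⟩₁ =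
Σ_{{X_r}} Π_c F^L_{k+1,loc}(X_c) ⟨Π_r F_{k,rem}(X_r)⟩₁, where ⟨·⟩₁ is the interacting expectation at t = 1. … Without going into
details, it is clear that the result can be written in the following form: ⟨Π_{σ₁} F^{m̄}_{k,loc}(X_{σ₁})⟩₁ = Σ_{{X_{r′}}} Π_{r′}
G_k(X_{r′}) Π_{c: X_c⊄∪_{r′}X_{r′}} F^L_{k+1,loc}(X_c). The X_{r′} are disjoint, and each one covers at least one X_{σ₁}, the support of
one of the observables F^{m̄}_{k,loc}. … To summarize the results of this section, we have e^{−V^{(k)}_{const}(Λ₈^{(k)})} Σ_{{X_α}} Π_α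
g₂(X_α) = Σ_{{X_α} overlapping Λ₁₁^{(k)c}} Π_α g₂(X_α) Σ_{{X_{r′}}} Π_{r′} G_k(X_{r′}) × Π_{c: X_c⊄∪_{r′}X_{r′}} F^L_{k+1,loc}(X_c)
exp(−𝒫^L_{k+1,loc}(Λ₈^{(k)}) − Σ_X W₆^{(k)}(X)). (5.14.5)"*.

WHAT IS REPRODUCED (unit `lit-balaban-p25`, generation 7 of the Phase-2 proof seat p25; SKELETON rows `C2.Eq5.14.5` (the display,
absent before) and `C2.Claim@312` (first display; the estimate |G_k(X)| stays `BIJ88Sect5StatementsPart4.Ineq312`); HOME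
`run/shared/lean/pub/lit-balaban/lit-balaban-p25/`).  Model = `BIJ88Resummation5141` over `ℝ`: cubes `W`, large-field cubes `B`,
fillings = set partitions, outer families `outer W B`, `Λ₁₂ = lam12 W ρ`, linear expectations `E W'`, cut-off `χ W'` (χ′_{W'}), observable
product `F W'` (Π_{σ₁: X_{σ₁}⊂W'} F^{m̄}_{k,loc}(X_{σ₁})), Boltzmann factors `b` (e^{−V^{(k)}(Y)}), `zF`.
§1 `expect1` = the interacting expectation ⟨·⟩₁ = ⟨·⟩_t at `t = 1` (normalized by `z = z_{F=1}`); `zF_div_z_eq_expect1` (p. 312 first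
  display, first equality, an identity of the model); `expect1_one`.
§2 `remFamilies` (*"The X_{r′} are disjoint, and each one covers at least one X_{σ₁}"*), `obs312` (the right side of the second display
  of p. 312 as a finite sum), `obs312_eq_prod_add` (empty remainder family = the purely perturbative term `Π_c F^L_{k+1,loc}(X_c)`).
§3 `eq5145` — (5.14.5) from: `eq5141` ((5.14.1), hypotheses `hYs`, `hg`, `hdec` of `BIJ88Resummation5141.eq5141` verbatim); and for every
  large-field-free region `W' ⊆ W` (every possible Λ₁₂): `hz` (`z(W') > 0`), `hlogz` (`log z = −𝒫̃_{k+1} − ℛ_k`: the (5.14.2) split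
  with `log z₀ = 0` — supplied from the shape of `BIJ88Sect5StatementsPart4.logz_split` in `eq5145_of_logz_split`), `hrem` (p. 310
  `ℛ_k = Σ_X W₆′(X)`; in the gen-6 model this is `BIJ88RemainderW6Prime.remR_eq_sum_W6'`), `h311` (p. 311, by assertion in print),
  `h312` (p. 312 second display, *"without going into details"* in print), the exponent `−𝒫^L − Σ_X (W₆′(X) + W₆″(X))` being the
  printed `−𝒫^L_{k+1,loc}(Λ₈) − Σ_X W₆(X)` with `W₆ := W₆′ + W₆″` (p. 311).  `eq5145_printed` (the observable factor in the printed form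
  `obs312`), `eq5145_of_logz_split`, `eq5145_action` (no observables: `F ≡ 1`, `⟨1⟩₁ = 1`, the extraction of the action alone).
HYPOTHESES, all displayed in the statements; the Λ₁₂-dependent quantities (𝒫̃_{k+1}, ℛ_k, W₆′, W₆″, G_k, X_c) are functions of the
region `W'`; the localization domains `X` of the W₆-terms range over a finite family `𝒳`.  READINGS (declared): (a) ⟨·⟩₁ normalized by
`z = z_{F=1}` as printed on p. 308; (b) `log z₀ = 0` encodes *"a purely Gaussian expectation"* at `t = 0` for the NORMALIZED measure
`dμ^{(k)}_{Λ₁₀}` of (5.12.7); (c) the constant components `X_c` form a fixed finite family per region (p. 312: *"the {X_c} are determined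
once the remainder components are specified"* is not modelled).  All statements are finite identities of real numbers; 0 `sorry`,
0 new `Prop` facts.
-/

open Finset
open Literature.Probability.LatticeModels (IsSetPartition setPartitions mem_setPartitions)
open Literature.MathematicalPhysics.QuantumFieldTheory.BalabanImbrieJaffe1984to88.BIJ88Resummation5141 (Overlaps outer lam12
  mem_outer lam12_subset disjoint_lam12 polysIn Compat restrictTo g2 boltz zF zS eq5141)
open Literature.MathematicalPhysics.QuantumFieldTheory.BalabanImbrieJaffe1984to88.BIJ88Sect5StatementsPart4 (pertP remR)

noncomputable section

namespace Literature.MathematicalPhysics.QuantumFieldTheory.BalabanImbrieJaffe1984to88.BIJ88Result5145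

variable {ι : Type*} [DecidableEq ι] {Φ : Type*}

/-! ## §1 The interacting expectation at `t = 1` and the first display of p. 312: `z_F/z = ⟨Π F^{m̄}_{k,loc}(X_{σ₁})⟩₁` -/

/-- p. 308 [PDF 52], verbatim: *"Here ⟨·⟩_t is the interacting expectation ⟨·⟩_t = (1/z_t(Λ₁₂^{(k)})) ⟨· χ′_{Λ₁₂^{(k)},t}
e^{−tṼ^{(k)}(Λ₁₂^{(k)})}⟩_{1,Λ₁₂^{(k)}}"*, at `t = 1` (p. 312: *"where ⟨·⟩₁ is the interacting expectation at t = 1"*): in the model of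
`BIJ88Resummation5141` (linear expectation `E W'` = ⟨·⟩_{1,W'}, cut-off observable `χ W'` = χ′_{W'}, Boltzmann factor `boltz Ys b W'` =
e^{−Ṽ(W')}) the normalized expectation `O ↦ E W'(χ′_{W'} · O · e^{−Ṽ(W')}) / z(W')`, `z(W') = z_{F=1}(W') = E W'(χ′_{W'} e^{−Ṽ(W')})`.
[cite: BalabanImbrieJaffe1988, (5.14.2) p.308] -/
def expect1 (E : Finset ι → (Φ → ℝ) →ₗ[ℝ] ℝ) (χ : Finset ι → Φ → ℝ) (Ys : Finset (Finset ι)) (b : Finset ι → Φ → ℝ)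
    (W' : Finset ι) (O : Φ → ℝ) : ℝ :=
  E W' (χ W' * O * boltz Ys b W') / zF E χ Ys b W'

/-- **p. 312 [PDF 56], first display, first equality**, verbatim: *"z_F/z = ⟨Π_{σ₁} F^{m̄}_{k,loc}(X_{σ₁})⟩₁"* — with `z_F` the `zF` of the
observable `χ′_{W'} · F(W')` (`F W'` = the product `Π_{σ₁: X_{σ₁}⊂W'} F^{m̄}_{k,loc}(X_{σ₁})`) and `z = z_{F=1}` the `zF` of `χ′_{W'}` alone
(p. 308 *"where z(Λ₁₂^{(k)}) = z_{F=1}(Λ₁₂^{(k)})"*): an identity of the model (definition of ⟨·⟩₁). [cite: BalabanImbrieJaffe1988, (5.14.5) p.312] -/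
theorem zF_div_z_eq_expect1 (E : Finset ι → (Φ → ℝ) →ₗ[ℝ] ℝ) (χ F : Finset ι → Φ → ℝ) (Ys : Finset (Finset ι))
    (b : Finset ι → Φ → ℝ) (W' : Finset ι) :
    zF E (fun W => χ W * F W) Ys b W' / zF E χ Ys b W' = expect1 E χ Ys b W' (F W') := rfl

/-- without observables (`F ≡ 1`) the interacting expectation of `1` is `1` and `z_F = z` (for `z ≠ 0`).
[cite: BalabanImbrieJaffe1988, (5.14.2) p.308] -/
theorem expect1_one (E : Finset ι → (Φ → ℝ) →ₗ[ℝ] ℝ) (χ : Finset ι → Φ → ℝ) (Ys : Finset (Finset ι))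
    (b : Finset ι → Φ → ℝ) (W' : Finset ι) (hz : zF E χ Ys b W' ≠ 0) : expect1 E χ Ys b W' 1 = 1 := by
  rw [expect1, mul_one]
  exact div_self hz

/-! ## §2 The second display of p. 312 (*"Without going into details, it is clear that the result can be written in the following
form"*): its right side typed -/

/-- p. 312 [PDF 56], the summation index `{X_{r′}}` of the second display, verbatim: *"The X_{r′} are disjoint, and each one covers at
least one X_{σ₁}, the support of one of the observables F^{m̄}_{k,loc}."* — families of pairwise disjoint nonempty sets of cubes of the
region `W'`, each containing one of the observable supports `Xσ`. [cite: BalabanImbrieJaffe1988, (5.14.5) p.312] -/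
def remFamilies (Xσ : Finset (Finset ι)) (W' : Finset ι) : Finset (Finset (Finset ι)) :=
  W'.powerset.powerset.filter fun ρ => IsSetPartition (ρ.biUnion id) ρ ∧ ∀ X ∈ ρ, ∃ S ∈ Xσ, S ⊆ X

/-- membership in `remFamilies`. [cite: BalabanImbrieJaffe1988, (5.14.5) p.312] -/
theorem mem_remFamilies {Xσ : Finset (Finset ι)} {W' : Finset ι} {ρ : Finset (Finset ι)} :
    ρ ∈ remFamilies Xσ W' ↔
      (∀ X ∈ ρ, X ⊆ W') ∧ IsSetPartition (ρ.biUnion id) ρ ∧ ∀ X ∈ ρ, ∃ S ∈ Xσ, S ⊆ X := by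
  simp only [remFamilies, mem_filter, mem_powerset]
  constructor
  · rintro ⟨h, h'⟩
    exact ⟨fun X hX => mem_powerset.1 (h hX), h'⟩
  · rintro ⟨h, h'⟩
    exact ⟨fun X hX => mem_powerset.2 (h X hX), h'⟩

/-- the empty remainder family is always admitted (the term *"all legs contracted"* / no remainder components).
[cite: BalabanImbrieJaffe1988, (5.14.5) p.312] -/
theorem empty_mem_remFamilies (Xσ : Finset (Finset ι)) (W' : Finset ι) : ∅ ∈ remFamilies Xσ W' := by
  refine mem_remFamilies.2 ⟨fun X hX => absurd hX (notMem_empty X), ?_, fun X hX => absurd hX (notMem_empty X)⟩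
  rw [biUnion_empty]
  exact Literature.Probability.LatticeModels.isSetPartition_empty_iff.2 rfl

/-- **p. 312 [PDF 56], second display, right side**, verbatim: *"⟨Π_{σ₁} F^{m̄}_{k,loc}(X_{σ₁})⟩₁ = Σ_{{X_{r′}}} Π_{r′} G_k(X_{r′})
Π_{c: X_c⊄∪_{r′}X_{r′}} F^L_{k+1,loc}(X_c)"* — the right side as a function of the region: remainder activities `Gk`, the next-scale
observables `FL` on the constant components `Xc` (p. 312: *"the {X_c} are determined once the remainder components are specified"* —
here a fixed family, the product keeping those not inside `∪X_{r′}`). [cite: BalabanImbrieJaffe1988, (5.14.5) p.312] -/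
def obs312 (Gk FL : Finset ι → ℝ) (Xσ Xc : Finset (Finset ι)) (W' : Finset ι) : ℝ :=
  ∑ ρ ∈ remFamilies Xσ W', (∏ X ∈ ρ, Gk X) * ∏ c ∈ Xc.filter (fun c => ¬ c ⊆ ρ.biUnion id), FL c

/-- the term of the empty remainder family is the full product of next-scale observables `Π_c F^L_{k+1,loc}(X_c)` (the purely
perturbative part of the observable). [cite: BalabanImbrieJaffe1988, (5.14.5) p.312] -/
theorem obs312_eq_prod_add (Gk FL : Finset ι → ℝ) (Xσ Xc : Finset (Finset ι)) (hXc : ∀ c ∈ Xc, c.Nonempty) (W' : Finset ι) :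
    obs312 Gk FL Xσ Xc W' =
      ∏ c ∈ Xc, FL c + ∑ ρ ∈ (remFamilies Xσ W').erase ∅, (∏ X ∈ ρ, Gk X) * ∏ c ∈ Xc.filter (fun c => ¬ c ⊆ ρ.biUnion id), FL c := by
  rw [obs312, ← add_sum_erase _ _ (empty_mem_remFamilies Xσ W'), prod_empty, one_mul, biUnion_empty,
    filter_true_of_mem (s := Xc) (p := fun c => ¬ c ⊆ ∅) fun c hc h => (hXc c hc).ne_empty (subset_empty.1 h)]

/-! ## §3 (5.14.5): the result of Sect. 5.14 assembled -/

/-- **(5.14.5)** p. 312 [PDF 56], verbatim: *"To summarize the results of this section, we have e^{−V^{(k)}_{const}(Λ₈^{(k)})} Σ_{{X_α}} Π_α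
g₂(X_α) = Σ_{{X_α} overlapping Λ₁₁^{(k)c}} Π_α g₂(X_α) Σ_{{X_{r′}}} Π_{r′} G_k(X_{r′}) × Π_{c: X_c⊄∪_{r′}X_{r′}} F^L_{k+1,loc}(X_c)
exp(−𝒫^L_{k+1,loc}(Λ₈^{(k)}) − Σ_X W₆^{(k)}(X)). (5.14.5)"* — ASSEMBLED in the model of `BIJ88Resummation5141` from (5.14.1)
(`eq5141`, hypotheses `hYs`/`hg`/`hdec` verbatim) and, for every large-field-free region `W' ⊆ W` (the possible Λ₁₂^{(k)}), the
displayed inputs: `hz` the normalization `z(W') = z_{F=1}(W') > 0`; `hlogz` the (5.14.2) split of `log z` into the perturbative terms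
`pert W'` = 𝒫̃_{k+1}(W') and the remainder `rem W'` = ℛ_k(W') with `log z₀ = 0` (p. 308: *"at t = 0 … a purely Gaussian
expectation"*, normalized — `BIJ88Sect5StatementsPart4.logz_split` gives the split for `t ↦ log z_t`, see `eq5145_of_logz_split`);
`hrem` p. 310 *"ℛ_k(Λ₁₂^{(k)}) = Σ_{X⊂Λ₁₂^{(k)}} W₆^{(k)′}(X)"* (derived in the gen-6 model as `BIJ88RemainderW6Prime.remR_eq_sum_W6'`);
`h311` p. 311 *"Altogether we have written V^{(k)}_{const}(Λ₈^{(k)}) + 𝒫̃_{k+1}(Λ₁₂^{(k)}) = 𝒫^L_{k+1,loc}(Λ₈^{(k)}) + Σ_X W₆^{(k)″}(X)"*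
(by assertion in print); `h312` p. 312 *"⟨Π_{σ₁} F^{m̄}_{k,loc}(X_{σ₁})⟩₁ = Σ_{{X_{r′}}} Π_{r′} G_k(X_{r′}) Π_{c} F^L_{k+1,loc}(X_c)"* (*"Without
going into details"*; the right side abstract as `obs W'`, its printed form is `obs312`, see `eq5145_printed`); and p. 311 *"If we put
W₆^{(k)}(X) = W₆^{(k)′}(X) + W₆^{(k)″}(X)"* (the exponent below). The localization domains `X` of the W₆-terms range over the finite
family `𝒳`. [cite: BalabanImbrieJaffe1988, (5.14.5) p.312] -/
theorem eq5145 (W B : Finset ι) (g : Finset ι → ℝ) (E : Finset ι → (Φ → ℝ) →ₗ[ℝ] ℝ) (χ F : Finset ι → Φ → ℝ)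
    (Ys : Finset (Finset ι)) (b : Finset ι → Φ → ℝ) (g₁ : Finset ι → Finset (Finset ι) → ℝ)
    (hYs : ∀ Y ∈ Ys, Y.Nonempty) (hg : ∀ X ⊆ W, X.Nonempty → Disjoint X B → g X = g2 Ys g₁ X)
    (hdec : ∀ W' ⊆ W, Disjoint W' B → ∀ S ⊆ polysIn Ys W',
      zS E (fun W => χ W * F W) b W' S = ∑ κ ∈ setPartitions W', if Compat κ S then ∏ X ∈ κ, g₁ X (restrictTo S X) else 0)
    (Vconst PL : ℝ) (𝒳 : Finset (Finset ι)) (pert rem obs : Finset ι → ℝ) (W6p W6pp : Finset ι → Finset ι → ℝ)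
    (hz : ∀ W' ⊆ W, Disjoint W' B → 0 < zF E χ Ys b W')
    (hlogz : ∀ W' ⊆ W, Disjoint W' B → Real.log (zF E χ Ys b W') = -pert W' - rem W')
    (hrem : ∀ W' ⊆ W, Disjoint W' B → rem W' = ∑ X ∈ 𝒳, W6p W' X)
    (h311 : ∀ W' ⊆ W, Disjoint W' B → Vconst + pert W' = PL + ∑ X ∈ 𝒳, W6pp W' X)
    (h312 : ∀ W' ⊆ W, Disjoint W' B → expect1 E χ Ys b W' (F W') = obs W') :
    Real.exp (-Vconst) * ∑ π ∈ setPartitions W, ∏ X ∈ π, g X =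
      ∑ ρ ∈ outer W B, (∏ X ∈ ρ, g X) * (obs (lam12 W ρ) *
        Real.exp (-PL - ∑ X ∈ 𝒳, (W6p (lam12 W ρ) X + W6pp (lam12 W ρ) X))) := by
  rw [eq5141 W B g E (fun W => χ W * F W) Ys b g₁ hYs hg hdec, mul_sum]
  refine sum_congr rfl fun ρ hρ => ?_
  have hW' : lam12 W ρ ⊆ W := lam12_subset W ρ
  have hdis : Disjoint (lam12 W ρ) B := disjoint_lam12 hρ
  set W' := lam12 W ρ with hW'def
  have hz' := hz W' hW' hdis
  -- `e^{−V_const} z_F = (z_F/z) · e^{log z − V_const} = obs · e^{−𝒫^L − Σ W₆″ − Σ W₆′}`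
  have hzF : zF E (fun W => χ W * F W) Ys b W' = obs W' * zF E χ Ys b W' := by
    rw [← h312 W' hW' hdis, ← zF_div_z_eq_expect1, div_mul_cancel₀ _ hz'.ne']
  have hexp : Real.exp (-Vconst) * zF E χ Ys b W' =
      Real.exp (-PL - ∑ X ∈ 𝒳, (W6p W' X + W6pp W' X)) := by
    rw [← Real.exp_log hz', ← Real.exp_add, hlogz W' hW' hdis, hrem W' hW' hdis]
    congr 1
    rw [sum_add_distrib]
    linarith [h311 W' hW' hdis]
  calc Real.exp (-Vconst) * ((∏ X ∈ ρ, g X) * zF E (fun W => χ W * F W) Ys b W')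
      = (∏ X ∈ ρ, g X) * (obs W' * (Real.exp (-Vconst) * zF E χ Ys b W')) := by rw [hzF]; ring
    _ = (∏ X ∈ ρ, g X) * (obs W' * Real.exp (-PL - ∑ X ∈ 𝒳, (W6p W' X + W6pp W' X))) := by rw [hexp]

/-- **(5.14.5) with the printed right side of p. 312** (`obs312`: *"Σ_{{X_{r′}}} Π_{r′} G_k(X_{r′}) Π_{c: X_c⊄∪X_{r′}} F^L_{k+1,loc}(X_c)"*,
remainder activities `Gk W'`, next-scale observables `FL`, observable supports `Xσ`, constant components `Xc W'`).
[cite: BalabanImbrieJaffe1988, (5.14.5) p.312] -/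
theorem eq5145_printed (W B : Finset ι) (g : Finset ι → ℝ) (E : Finset ι → (Φ → ℝ) →ₗ[ℝ] ℝ) (χ F : Finset ι → Φ → ℝ)
    (Ys : Finset (Finset ι)) (b : Finset ι → Φ → ℝ) (g₁ : Finset ι → Finset (Finset ι) → ℝ)
    (hYs : ∀ Y ∈ Ys, Y.Nonempty) (hg : ∀ X ⊆ W, X.Nonempty → Disjoint X B → g X = g2 Ys g₁ X)
    (hdec : ∀ W' ⊆ W, Disjoint W' B → ∀ S ⊆ polysIn Ys W',
      zS E (fun W => χ W * F W) b W' S = ∑ κ ∈ setPartitions W', if Compat κ S then ∏ X ∈ κ, g₁ X (restrictTo S X) else 0)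
    (Vconst PL : ℝ) (𝒳 Xσ : Finset (Finset ι)) (Xc : Finset ι → Finset (Finset ι)) (pert rem : Finset ι → ℝ)
    (Gk : Finset ι → Finset ι → ℝ) (FL : Finset ι → ℝ) (W6p W6pp : Finset ι → Finset ι → ℝ)
    (hz : ∀ W' ⊆ W, Disjoint W' B → 0 < zF E χ Ys b W')
    (hlogz : ∀ W' ⊆ W, Disjoint W' B → Real.log (zF E χ Ys b W') = -pert W' - rem W')
    (hrem : ∀ W' ⊆ W, Disjoint W' B → rem W' = ∑ X ∈ 𝒳, W6p W' X)
    (h311 : ∀ W' ⊆ W, Disjoint W' B → Vconst + pert W' = PL + ∑ X ∈ 𝒳, W6pp W' X)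
    (h312 : ∀ W' ⊆ W, Disjoint W' B → expect1 E χ Ys b W' (F W') = obs312 (Gk W') FL Xσ (Xc W') W') :
    Real.exp (-Vconst) * ∑ π ∈ setPartitions W, ∏ X ∈ π, g X =
      ∑ ρ ∈ outer W B, (∏ X ∈ ρ, g X) *
        ((∑ ρ' ∈ remFamilies Xσ (lam12 W ρ), (∏ X ∈ ρ', Gk (lam12 W ρ) X) *
            ∏ c ∈ (Xc (lam12 W ρ)).filter (fun c => ¬ c ⊆ ρ'.biUnion id), FL c) *
          Real.exp (-PL - ∑ X ∈ 𝒳, (W6p (lam12 W ρ) X + W6pp (lam12 W ρ) X))) :=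
  eq5145 W B g E χ F Ys b g₁ hYs hg hdec Vconst PL 𝒳 pert rem (fun W' => obs312 (Gk W') FL Xσ (Xc W') W') W6p W6pp
    hz hlogz hrem h311 h312

/-- **(5.14.5) with `log z` split by Taylor's formula as in (5.14.2)**: the hypothesis `hlogz` of `eq5145` supplied by the (5.14.2)
bookkeeping of `BIJ88Sect5StatementsPart4` — for each large-field-free region a function `logz W' : ℝ → ℝ` (`t ↦ log z_t(W')`) with
`logz W' 1 = log z(W')`, `logz W' 0 = 0` (p. 308: *"the restrictions and the interactions disappear at t = 0, at which point we have a
purely Gaussian expectation"* — normalized), the Taylor split `logz W' 1 = logz W' 0 − 𝒫̃ − ℛ` (the conclusion of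
`BIJ88Sect5StatementsPart4.logz_split`, i.e. `pert W' = pertP (logz W') n̄`, `rem W' = remR (trunc W') n̄`).
[cite: BalabanImbrieJaffe1988, (5.14.5) p.312] -/
theorem eq5145_of_logz_split (W B : Finset ι) (g : Finset ι → ℝ) (E : Finset ι → (Φ → ℝ) →ₗ[ℝ] ℝ) (χ F : Finset ι → Φ → ℝ)
    (Ys : Finset (Finset ι)) (b : Finset ι → Φ → ℝ) (g₁ : Finset ι → Finset (Finset ι) → ℝ)
    (hYs : ∀ Y ∈ Ys, Y.Nonempty) (hg : ∀ X ⊆ W, X.Nonempty → Disjoint X B → g X = g2 Ys g₁ X)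
    (hdec : ∀ W' ⊆ W, Disjoint W' B → ∀ S ⊆ polysIn Ys W',
      zS E (fun W => χ W * F W) b W' S = ∑ κ ∈ setPartitions W', if Compat κ S then ∏ X ∈ κ, g₁ X (restrictTo S X) else 0)
    (Vconst PL : ℝ) (𝒳 : Finset (Finset ι)) (nbar : ℕ) (logz trunc : Finset ι → ℝ → ℝ) (obs : Finset ι → ℝ)
    (W6p W6pp : Finset ι → Finset ι → ℝ)
    (hz : ∀ W' ⊆ W, Disjoint W' B → 0 < zF E χ Ys b W')
    (hz1 : ∀ W' ⊆ W, Disjoint W' B → logz W' 1 = Real.log (zF E χ Ys b W'))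
    (hz0 : ∀ W' ⊆ W, Disjoint W' B → logz W' 0 = 0)
    (hsplit : ∀ W' ⊆ W, Disjoint W' B → logz W' 1 = logz W' 0 - pertP (logz W') nbar - remR (trunc W') nbar)
    (hrem : ∀ W' ⊆ W, Disjoint W' B → remR (trunc W') nbar = ∑ X ∈ 𝒳, W6p W' X)
    (h311 : ∀ W' ⊆ W, Disjoint W' B → Vconst + pertP (logz W') nbar = PL + ∑ X ∈ 𝒳, W6pp W' X)
    (h312 : ∀ W' ⊆ W, Disjoint W' B → expect1 E χ Ys b W' (F W') = obs W') :
    Real.exp (-Vconst) * ∑ π ∈ setPartitions W, ∏ X ∈ π, g X =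
      ∑ ρ ∈ outer W B, (∏ X ∈ ρ, g X) * (obs (lam12 W ρ) *
        Real.exp (-PL - ∑ X ∈ 𝒳, (W6p (lam12 W ρ) X + W6pp (lam12 W ρ) X))) :=
  eq5145 W B g E χ F Ys b g₁ hYs hg hdec Vconst PL 𝒳 (fun W' => pertP (logz W') nbar) (fun W' => remR (trunc W') nbar) obs
    W6p W6pp hz (fun W' hW' hdis => by rw [← hz1 W' hW' hdis, hsplit W' hW' hdis, hz0 W' hW' hdis]; ring) hrem h311 h312

/-- **the action part alone** (no observables: `F ≡ 1`, so `⟨1⟩₁ = 1` and `z_F = z`): `e^{−V_const} Σ_{{X_α}} Π g₂ = Σ_{{X_α} overlapping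
Λ₁₁ᶜ} Π g₂ · exp(−𝒫^L_{k+1,loc}(Λ₈) − Σ_X W₆(X))` — the extraction of the effective action 𝒫^L_{k+1,loc} in (5.14.5).
[cite: BalabanImbrieJaffe1988, (5.14.5) p.312] -/
theorem eq5145_action (W B : Finset ι) (g : Finset ι → ℝ) (E : Finset ι → (Φ → ℝ) →ₗ[ℝ] ℝ) (χ : Finset ι → Φ → ℝ)
    (Ys : Finset (Finset ι)) (b : Finset ι → Φ → ℝ) (g₁ : Finset ι → Finset (Finset ι) → ℝ)
    (hYs : ∀ Y ∈ Ys, Y.Nonempty) (hg : ∀ X ⊆ W, X.Nonempty → Disjoint X B → g X = g2 Ys g₁ X)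
    (hdec : ∀ W' ⊆ W, Disjoint W' B → ∀ S ⊆ polysIn Ys W',
      zS E χ b W' S = ∑ κ ∈ setPartitions W', if Compat κ S then ∏ X ∈ κ, g₁ X (restrictTo S X) else 0)
    (Vconst PL : ℝ) (𝒳 : Finset (Finset ι)) (pert rem : Finset ι → ℝ) (W6p W6pp : Finset ι → Finset ι → ℝ)
    (hz : ∀ W' ⊆ W, Disjoint W' B → 0 < zF E χ Ys b W')
    (hlogz : ∀ W' ⊆ W, Disjoint W' B → Real.log (zF E χ Ys b W') = -pert W' - rem W')
    (hrem : ∀ W' ⊆ W, Disjoint W' B → rem W' = ∑ X ∈ 𝒳, W6p W' X)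
    (h311 : ∀ W' ⊆ W, Disjoint W' B → Vconst + pert W' = PL + ∑ X ∈ 𝒳, W6pp W' X) :
    Real.exp (-Vconst) * ∑ π ∈ setPartitions W, ∏ X ∈ π, g X =
      ∑ ρ ∈ outer W B, (∏ X ∈ ρ, g X) * Real.exp (-PL - ∑ X ∈ 𝒳, (W6p (lam12 W ρ) X + W6pp (lam12 W ρ) X)) := by
  have h := eq5145 W B g E χ (fun _ => 1) Ys b g₁ hYs hg
    (fun W' hW' hdis S hS => by simpa only [mul_one] using hdec W' hW' hdis S hS)
    Vconst PL 𝒳 pert rem (fun _ => 1) W6p W6pp hz hlogz hrem h311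
    (fun W' hW' hdis => expect1_one E χ Ys b W' (hz W' hW' hdis).ne')
  simpa only [one_mul] using h

end Literature.MathematicalPhysics.QuantumFieldTheory.BalabanImbrieJaffe1984to88.BIJ88Result5145
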